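import Mathlib

/-!
# Route `FilamentSkeletonRss` · child crux `TangentSkeletonNearStraightL` (stmt-NavierStokesRegularity-23320) · registered line
# `child_tangent_analytic_strip_L` (b0b56c52900dd90a), stub `stub_stripPropagation` — brick: VERTICAL DISPLACEMENT IN THE STADIUM
# AND THE PRINCIPAL BRANCH FOR UNSHIFTED (PARTNER / FAR) SOURCE POINTS

The contour-shift proof of `StripPropagation` never shifts the partner filaments (`8cs ≤ ρ`) nor the own filament far from the
diagonal; there the matched kernel `(Σᵢ (Fᵢ(z) − qᵢ)² + κ·A)^{-3/2}` is evaluated at a COMPLEX point `F(z)` of the stadium-analytic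
extension of one filament and a REAL source point `q`, and stays on its principal branch because the complexified squared distance has
positive real part.  This file proves the two elementary facts behind that:
* `norm_sub_le_of_vertical_segment` — if `F` is complex-differentiable on an open `U ⊆ ℂ` with `‖F′‖ ≤ B` there and the vertical
  segment from `x` to `x + iy` lies in `U`, then `‖F(x+iy) − F(x)‖ ≤ B|y|` (mean value inequality along the segment);
* `re_sum_sq_add_ge` — for a real vector `u` and a complex perturbation `e` with `‖eᵢ‖ ≤ η`:
  `Re Σᵢ (uᵢ + eᵢ)² ≥ Σᵢ uᵢ² − 2η Σᵢ |uᵢ| − 3η²`;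
* `re_sum_sq_sub_ge_of_vertical` — the combination: with `F(x) = (Xᵢ(x))ᵢ` real,
  `Re Σᵢ (Fᵢ(x+iy) − qᵢ)² ≥ ‖X(x) − q‖² − 2B|y|·Σᵢ|Xᵢ(x) − qᵢ| − 3B²y²` — positive as soon as `‖X(x) − q‖ ≫ B|y|`
  (in the stub: `B = 2`, `|y| < cs√Γ/4`, `‖X(x) − q‖ ≥ ρ√Γ ≥ 8cs√Γ`).
HONEST FRAMING: elementary bricks for a plan about a HYPOTHETICAL filament skeleton on the NEGATIVE side of a MODEL route; the stub
`stub_stripPropagation` is NOT closed; nothing here bears on Navier–Stokes regularity or blow-up.  `--supports stmt-NavierStokesRegularity-23320`.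
-/

set_option linter.dupNamespace false

noncomputable section

namespace Summit.NavierStokesRegularity.NavierStokesRegularity.Theorems.StadiumVerticalDisplacement

open Set Filter Topology
open scoped BigOperators

/-- **Vertical displacement in the stadium.**  `F : ℂ → ℂ³` complex-differentiable on an open `U` with `‖F′ z‖ ≤ B` on `U`; if the
vertical segment `{x + it : t between 0 and y}` lies in `U` then `‖F(x + iy) − F(x)‖ ≤ B·|y|` (sup norm on `ℂ³`). [folklore] -/
theorem norm_sub_le_of_vertical_segment {U : Set ℂ} (hU : IsOpen U) {F : ℂ → (Fin 3 → ℂ)} (hF : DifferentiableOn ℂ F U)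
    {B : ℝ} (hB : ∀ z ∈ U, ‖deriv F z‖ ≤ B) {x y : ℝ}
    (hseg : ∀ t ∈ Set.uIcc 0 y, (x : ℂ) + (t : ℂ) * Complex.I ∈ U) :
    ‖F ((x : ℂ) + (y : ℂ) * Complex.I) - F x‖ ≤ B * |y| := by
  set g : ℝ → (Fin 3 → ℂ) := fun t => F ((x : ℂ) + (t : ℂ) * Complex.I) with hg
  have hpath : ∀ t : ℝ, HasDerivAt (fun t : ℝ => (x : ℂ) + (t : ℂ) * Complex.I) Complex.I t := by
    intro t
    have h1 : HasDerivAt (fun t : ℝ => ((t : ℝ) : ℂ)) ((1 : ℝ) : ℂ) t := (hasDerivAt_id t).ofReal_comp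
    have h2 := (h1.mul_const Complex.I).const_add (x : ℂ)
    simpa using h2
  have hgd : ∀ t ∈ Set.uIcc 0 y,
      HasDerivWithinAt g (Complex.I • deriv F ((x : ℂ) + (t : ℂ) * Complex.I)) (Set.uIcc 0 y) t := by
    intro t ht
    have hFd : HasDerivAt F (deriv F ((x : ℂ) + (t : ℂ) * Complex.I)) ((x : ℂ) + (t : ℂ) * Complex.I) :=
      (hF.differentiableAt (hU.mem_nhds (hseg t ht))).hasDerivAt
    exact (hFd.scomp t (hpath t)).hasDerivWithinAt
  have hbound : ∀ t ∈ Set.uIcc 0 y, ‖Complex.I • deriv F ((x : ℂ) + (t : ℂ) * Complex.I)‖ ≤ B := by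
    intro t ht
    rw [norm_smul, Complex.norm_I, one_mul]
    exact hB _ (hseg t ht)
  have key := (convex_uIcc (0:ℝ) y).norm_image_sub_le_of_norm_hasDerivWithin_le hgd hbound
    (left_mem_uIcc) (right_mem_uIcc)
  have h0 : g 0 = F x := by simp [hg]
  have hy : g y = F ((x : ℂ) + (y : ℂ) * Complex.I) := rfl
  rw [h0, hy] at key
  simpa using key

/-- **Real part of a perturbed real square sum.**  For `u : ℝ³` and a complex perturbation `e` with `‖eᵢ‖ ≤ η`:
`Σᵢ uᵢ² − 2η·Σᵢ |uᵢ| − 3η² ≤ Re Σᵢ (uᵢ + eᵢ)²`. [folklore] -/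
theorem re_sum_sq_add_ge (u : Fin 3 → ℝ) (e : Fin 3 → ℂ) {η : ℝ} (he : ∀ i, ‖e i‖ ≤ η) :
    (∑ i, (u i) ^ 2) - 2 * η * (∑ i, |u i|) - 3 * η ^ 2 ≤ (∑ i, ((u i : ℂ) + e i) ^ 2).re := by
  have hterm : ∀ i, (u i) ^ 2 - 2 * η * |u i| - η ^ 2 ≤ (((u i : ℂ) + e i) ^ 2).re := by
    intro i
    have hre : (((u i : ℂ) + e i) ^ 2).re = (u i + (e i).re) ^ 2 - ((e i).im) ^ 2 := by
      simp only [sq, Complex.mul_re, Complex.add_re, Complex.add_im, Complex.ofReal_re, Complex.ofReal_im, zero_add]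
    rw [hre]
    have h1 : |(e i).re| ≤ η := (Complex.abs_re_le_norm _).trans (he i)
    have h2 : |(e i).im| ≤ η := (Complex.abs_im_le_norm _).trans (he i)
    have h3 : -(|u i| * η) ≤ u i * (e i).re := by
      have h4 : |u i * (e i).re| ≤ |u i| * η := by
        rw [abs_mul]; exact mul_le_mul_of_nonneg_left h1 (abs_nonneg _)
      linarith [neg_abs_le (u i * (e i).re)]
    have h5 : ((e i).im) ^ 2 ≤ η ^ 2 := sq_le_sq' (abs_le.1 h2).1 (abs_le.1 h2).2
    nlinarith [h3, h5, sq_nonneg ((e i).re)]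
  calc (∑ i, (u i) ^ 2) - 2 * η * (∑ i, |u i|) - 3 * η ^ 2 = ∑ i, ((u i) ^ 2 - 2 * η * |u i| - η ^ 2) := by
        simp only [Fin.sum_univ_three]; ring
    _ ≤ ∑ i, (((u i : ℂ) + e i) ^ 2).re := Finset.sum_le_sum fun i _ => hterm i
    _ = (∑ i, ((u i : ℂ) + e i) ^ 2).re := (Complex.re_sum _ _).symm

/-- **Principal branch for unshifted source points.**  `F : ℂ → ℂ³` complex-differentiable on an open `U` with `‖F′‖ ≤ B`,
the vertical segment from `x` to `x + iy` in `U`, and `F(x) = (Xᵢ(x))ᵢ` real (the stadium-analytic extension of the filament `X` at a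
real foot); then for every real point `q`:
`‖X(x) − q‖² − 2B|y|·Σᵢ |Xᵢ(x) − qᵢ| − 3B²y² ≤ Re Σᵢ (Fᵢ(x+iy) − qᵢ)²`. [folklore] -/
theorem re_sum_sq_sub_ge_of_vertical {U : Set ℂ} (hU : IsOpen U) {F : ℂ → (Fin 3 → ℂ)} (hF : DifferentiableOn ℂ F U)
    {B : ℝ} (hB : ∀ z ∈ U, ‖deriv F z‖ ≤ B) {X : ℝ → EuclideanSpace ℝ (Fin 3)} {x y : ℝ}
    (hseg : ∀ t ∈ Set.uIcc 0 y, (x : ℂ) + (t : ℂ) * Complex.I ∈ U)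
    (hFx : F x = fun i => ((X x i : ℝ) : ℂ)) (q : EuclideanSpace ℝ (Fin 3)) :
    ‖X x - q‖ ^ 2 - 2 * (B * |y|) * (∑ i, |X x i - q i|) - 3 * (B * |y|) ^ 2 ≤
      (∑ i, (F ((x : ℂ) + (y : ℂ) * Complex.I) i - (q i : ℂ)) ^ 2).re := by
  set e : Fin 3 → ℂ := F ((x : ℂ) + (y : ℂ) * Complex.I) - F x with hedef
  have he_norm : ‖e‖ ≤ B * |y| := norm_sub_le_of_vertical_segment hU hF hB hseg
  have he : ∀ i, ‖e i‖ ≤ B * |y| := fun i => (norm_le_pi_norm e i).trans he_norm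
  have hdecomp : ∀ i, F ((x : ℂ) + (y : ℂ) * Complex.I) i - (q i : ℂ) = ((X x i - q i : ℝ) : ℂ) + e i := by
    intro i
    have hFxi : F x i = ((X x i : ℝ) : ℂ) := by rw [hFx]
    simp only [hedef, Pi.sub_apply, hFxi, Complex.ofReal_sub]
    ring
  have hnorm : ‖X x - q‖ ^ 2 = ∑ i, (X x i - q i) ^ 2 := by
    rw [EuclideanSpace.real_norm_sq_eq]
    rfl
  have hmain := re_sum_sq_add_ge (fun i => X x i - q i) e he
  rw [hnorm]
  calc (∑ i, (X x i - q i) ^ 2) - 2 * (B * |y|) * (∑ i, |X x i - q i|) - 3 * (B * |y|) ^ 2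
        ≤ (∑ i, (((X x i - q i : ℝ) : ℂ) + e i) ^ 2).re := hmain
    _ = (∑ i, (F ((x : ℂ) + (y : ℂ) * Complex.I) i - (q i : ℂ)) ^ 2).re := by
        simp only [hdecomp]

end Summit.NavierStokesRegularity.NavierStokesRegularity.Theorems.StadiumVerticalDisplacement

end
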